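import Summits.Ventures.YMGap.RobustBall.RobustSlabDoorPair
import Summits.Ventures.YMGap.RobustBall.RowsSU3Certified
import Summits.Ventures.YMGap.Thresholds.OneLinkVarianceBoundSU2
import HarnessLib

/-!
# Venture YMGap, track Y2 ROBUST-BALL — `SU(3)` AREA-LAW ROWS ON THE BALL through the Holley–Stroock pair door (row 3c's door),
# on the cell's certified pairs, `d = 4` and `d = 3`; plus the hypothesis-free `SU(2)` pair schemas (rows left to rb-p2)

HONEST FRAMING.  Venture file of the cell `pub-ymgap` (QuantumFields programme), seat engine-2 (g6).  Strong-coupling LATTICE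
statements only: `SU(N)` lattice Yang–Mills on the tori `(ℤ/L)^d` (uniform in `L`), Wilson's action at tree coupling `β_W/N` plus a
member of rb-theory's tier-1 ball `ClusterDomainFR ε₀ ε₁ r` with vertical dependence diameter `mv`; conclusion = Wilson's AREA LAW for
rectangular loops, constants uniform on the ball (`RobustBall.AreaLawOnBall`).  Nothing about the continuum, an infinite-volume string
tension, weak coupling, a mass gap, or Clay.  Kernel ARITHMETIC over `RobustSlabDoorPair.areaLawOnBall_of_pair` (row condition
`e^{ε₀}·2n|β/N|√(c v) + √(e^{ε₀} c)·ε₁ < 1`, NO self-Lipschitz load) on: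
* `SU(2)`, HYPOTHESIS-FREE pairs of the tree: A = `(c, v) = (2/3, 8/3)` at every radius (`oneLinkPoincareSUN_two_sharp` +
  `RobustBall.linVariance_of_poincare`), B = `(2/3, 2)` on radius `3/10` (`oneLinkVarianceBound_two_threeTenths`, engine-2 g5);
* `SU(3)`, the cell's CERTIFIED pairs P11 (H1 `OneLinkPoincareSUN 3 (3/5) (4/5)` + H2 `OneLinkVarianceBound 3 (11/30) (49/20)`, `√(cv) = 7/5`)
  and P35 (H1 + H2′ `OneLinkVarianceBound 3 (3/5) (17/5)`, `√(cv) = √68/5 ≤ 1.6493`); NOTHING asserted about H1/H2/H2′ — the `SU(3)` rows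
  are K-conditional on the displayed pair (classes «K × C(H1) × C-iv(H2)» / «K × C(H1) × C⁻(H2′)»), never K.

THE ROWS (currency `AreaLawOnBall 3 d (β_W/3) (2ε) ε r mv` FOR EVERY range `r` AND EVERY vertical diameter `mv ≥ 1`; one-parameter
convention `ε₀ = 2ε`, `ε₁ = ε`, `1/1000` granularity rounded down; exact rational certificates with `e^x ≤ T(x) = 1 + x + x²/2 + x³/6 + (5/96)x⁴`
on `[0,1]`, `√(e^{2ε}c) = e^ε √c`, `√(4/5) ≤ 0.8945`, `√68/5 ≤ 1.6493`):
* `SU(3)`, `d = 4` (`c_W = (2/3)Kβ_W`), P11: `(1/4, .381) (1/3, .325) (2/5, .285) (9/20, .257) (1/2, .230) (11/20, .205)`; P35: `(3/5, .134) (2/3, .102)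
  (7/10, .086) (3/4, .064) (4/5, .043)` — versus `(1/2, .160)`, `(11/20, .138)`, `(3/4, .036)` through the `√N`-cross-leg vertex door
  (`AreaLawRowsSU3Certified`).  `SU(3)`, `d = 3` (`c_W = (4/9)Kβ_W`): P11 `(1/2, .325) (3/4, .230) (33/40, .205)`; P35 `(9/10, .134) (1, .102)
  (11/10, .071) (6/5, .043)` (a Y2 table entry; Y4 consumes the clustering currency, not this one).
* `SU(2)` (split of record: rows are rb-p2's): only the every-`d` SCHEMAS on the tree's hypothesis-free pairs A `(2/3, 8/3)` (every radius)
  and B `(2/3, 2)` (radius `3/10`) are recorded here (`su2_areaLawOnBall_pairA/B`); float screen of what they give at `d = 4`: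
  B `(1/8, .411) (1/5, .313)`, A `(1/4, .219) (1/3, .135)` — within `1–6 %` of, resp. below, rb-p2's affine-vertex quarter-modulus rows, so the
  Holley–Stroock door matters for `SU(3)` (no quarter modulus), not for `SU(2)`.
-/

noncomputable section

open MeasureTheory ProbabilityTheory Real
open Literature.MathematicalPhysics.QuantumFieldTheory
open Summit.QuantumFields.BalabanUV.InfraRed.StrongCouplingPoincareDoorSUN
  (OneLinkPoincareSUN OneLinkPoincareSUN.mono oneLinkPoincareSUN_two_sharp)
open Summit.QuantumFields.BalabanUV.InfraRed.StrongCouplingVarianceDoorSUN (OneLinkVarianceBound OneLinkVarianceBound.mono)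
open Summit.Ventures.YMGap.RobustBall (AreaLawOnBall areaLawOnBall_of_pair linVariance_of_poincare)
open Summit.Ventures.YMGap.RobustBallSU3 (exp_le_taylor4 sqrt_four_fifths_le)
open Summit.Ventures.YMGap.OneLinkVarianceBoundSU2 (oneLinkVarianceBound_two_threeTenths)

namespace Summit.Ventures.YMGap.RobustBallPair

variable {n : ℕ}

/-! ### 1. The Holley–Stroock row sum under the Taylor majorant -/

/-- `√(e^{2ε} c) = e^ε √c`. [folklore] -/
theorem sqrt_exp_two_mul_mul (ε c : ℝ) : Real.sqrt (exp (2 * ε) * c) = exp ε * Real.sqrt c := by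
  rw [show exp (2 * ε) = exp ε ^ 2 by rw [sq, ← Real.exp_add]; ring_nf, Real.sqrt_mul (sq_nonneg _),
    Real.sqrt_sq (exp_pos _).le]

/-- The Holley–Stroock row sum under the majorants: for `0 ≤ ε ≤ 1/2`, `0 ≤ A ≤ A'`, `0 ≤ c`, `√c ≤ s₀`,
`e^{2ε}A + √(e^{2ε}c)·ε ≤ T(2ε)A' + T(ε)s₀ε`. [folklore] -/
theorem hs_rowsum_majorant {ε A A' c s₀ : ℝ} (hε0 : 0 ≤ ε) (hε1 : ε ≤ 1 / 2) (hA0 : 0 ≤ A) (hA : A ≤ A')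
    (hs : Real.sqrt c ≤ s₀) :
    exp (2 * ε) * A + Real.sqrt (exp (2 * ε) * c) * ε ≤
      (1 + 2 * ε + (2 * ε) ^ 2 / 2 + (2 * ε) ^ 3 / 6 + 5 / 96 * (2 * ε) ^ 4) * A' +
        (1 + ε + ε ^ 2 / 2 + ε ^ 3 / 6 + 5 / 96 * ε ^ 4) * s₀ * ε := by
  rw [sqrt_exp_two_mul_mul]
  have h1 : exp (2 * ε) * A ≤ (1 + 2 * ε + (2 * ε) ^ 2 / 2 + (2 * ε) ^ 3 / 6 + 5 / 96 * (2 * ε) ^ 4) * A' :=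
    mul_le_mul (exp_le_taylor4 (by linarith) (by linarith)) hA hA0 (by positivity)
  have h2 : exp ε * Real.sqrt c * ε ≤ (1 + ε + ε ^ 2 / 2 + ε ^ 3 / 6 + 5 / 96 * ε ^ 4) * s₀ * ε :=
    mul_le_mul_of_nonneg_right (mul_le_mul (exp_le_taylor4 hε0 (by linarith)) hs (Real.sqrt_nonneg _) (by positivity)) hε0
  linarith

/-! ### 2. `SU(2)`: hypothesis-free pairs A `(2/3, 8/3)` (every radius) and B `(2/3, 2)` (radius `3/10`) -/

/-- **`SU(2)` pair A, variance factor**: `OneLinkVarianceBound 2 R (8/3)` at EVERY radius — the tree's sharp Poincaré constant `2/3`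
(`oneLinkPoincareSUN_two_sharp`) on the `2‖Δ‖_F`-Lipschitz linear observable (`linVariance_of_poincare`). [folklore] -/
theorem su2_oneLinkVarianceBound_eightThirds (R : ℝ) : OneLinkVarianceBound 2 R (8 / 3) := by
  intro B hB Δ
  have h := linVariance_of_poincare (N := 2) (b := R) (c := 2 / 3)
    (fun B hB ψ M hM hψ => oneLinkPoincareSUN_two_sharp R B hB ψ M hM hψ) B hB Δ
  have e : (2 / 3 : ℝ) * ((2 : ℕ) : ℝ) ^ 2 = 8 / 3 := by norm_num
  rwa [e] at h

/-- `|β_W/2/2| = |β_W|/4`. [folklore] -/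
theorem abs_div_two_div_two (βW : ℝ) : |βW / 2 / ((2 : ℕ) : ℝ)| = |βW| / 4 := by
  rw [Nat.cast_ofNat, div_div, abs_div, abs_of_pos (by norm_num : (0 : ℝ) < 2 * 2)]
  norm_num

/-- `√((2/3)(8/3)) = 4/3`. [folklore] -/
theorem sqrt_pairA : Real.sqrt (2 / 3 * (8 / 3)) = 4 / 3 := by
  rw [show (2 / 3 * (8 / 3) : ℝ) = (4 / 3) ^ 2 by norm_num, Real.sqrt_sq (by norm_num)]

/-- **`SU(2)`, every `d = n + 1`, pair A (hypothesis-free, every `β_W`)**: the Holley–Stroock row condition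
`e^{ε₀}·2n(|β_W|/4)(4/3) + √(e^{ε₀}(2/3))·ε₁ < 1` gives `AreaLawOnBall 2 (n+1) (β_W/2) ε₀ ε₁ r mv`. [folklore] -/
theorem su2_areaLawOnBall_pairA {βW ε₀ ε₁ : ℝ} (h₁ : 0 ≤ ε₁) (r : ℕ) {mv : ℕ} (hmv : 1 ≤ mv)
    (hrow : exp ε₀ * (2 * (n : ℝ) * (|βW| / 4) * (4 / 3)) + Real.sqrt (exp ε₀ * (2 / 3)) * ε₁ < 1) :
    AreaLawOnBall 2 (n + 1) (βW / 2) ε₀ ε₁ r mv := by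
  refine areaLawOnBall_of_pair (n := n) le_rfl (βW / 2) (R := 2 * (n : ℝ) * (|βW| / 4)) (by norm_num) (by norm_num)
    (oneLinkPoincareSUN_two_sharp _) (su2_oneLinkVarianceBound_eightThirds _) ?_ h₁ r hmv ?_
  · rw [abs_div_two_div_two]; linarith
  · rw [abs_div_two_div_two, sqrt_pairA]; exact hrow

/-- **`SU(2)`, every `d = n + 1`, pair B (hypothesis-free on radius `3/10`, i.e. `2n|β_W|/4 ≤ 3/10`)**: the row condition
`e^{ε₀}·2n(|β_W|/4)√(4/3) + √(e^{ε₀}(2/3))·ε₁ < 1` gives `AreaLawOnBall 2 (n+1) (β_W/2) ε₀ ε₁ r mv`. [folklore] -/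
theorem su2_areaLawOnBall_pairB {βW ε₀ ε₁ : ℝ} (hR : 2 * (n : ℝ) * (|βW| / 4) ≤ 3 / 10) (h₁ : 0 ≤ ε₁) (r : ℕ) {mv : ℕ}
    (hmv : 1 ≤ mv)
    (hrow : exp ε₀ * (2 * (n : ℝ) * (|βW| / 4) * Real.sqrt (2 / 3 * 2)) + Real.sqrt (exp ε₀ * (2 / 3)) * ε₁ < 1) :
    AreaLawOnBall 2 (n + 1) (βW / 2) ε₀ ε₁ r mv := by
  refine areaLawOnBall_of_pair (n := n) le_rfl (βW / 2) (by norm_num) (by norm_num)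
    (oneLinkPoincareSUN_two_sharp _) oneLinkVarianceBound_two_threeTenths ?_ h₁ r hmv ?_
  · rw [abs_div_two_div_two]; linarith
  · rw [abs_div_two_div_two]; exact hrow

/-! ### 3. `SU(3)` on the certified pairs P11 and P35 -/

/-- **`SU(3)`, every `d = n + 1`, Holley–Stroock door on a symbolic pair**: GIVEN `OneLinkPoincareSUN 3 R c`, `OneLinkVarianceBound 3 R v`
(`0 ≤ c, v`, `R ≥ 2n|β_W|/9`), the row condition `e^{ε₀}·2n(|β_W|/9)√(cv) + √(e^{ε₀}c)·ε₁ < 1` gives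
`AreaLawOnBall 3 (n+1) (β_W/3) ε₀ ε₁ r mv`. [folklore] -/
theorem su3_areaLawOnBallHS_of_pair {R c v βW ε₀ ε₁ : ℝ} (hc : 0 ≤ c) (hv : 0 ≤ v)
    (hP : OneLinkPoincareSUN 3 R c) (hV : OneLinkVarianceBound 3 R v) (hR : |βW| / 9 * (2 * (n : ℝ)) ≤ R)
    (h₁ : 0 ≤ ε₁) (r : ℕ) {mv : ℕ} (hmv : 1 ≤ mv)
    (hrow : exp ε₀ * (2 * (n : ℝ) * (|βW| / 9) * Real.sqrt (c * v)) + Real.sqrt (exp ε₀ * c) * ε₁ < 1) :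
    AreaLawOnBall 3 (n + 1) (βW / 3) ε₀ ε₁ r mv := by
  have habs : |βW / 3 / ((3 : ℕ) : ℝ)| = |βW| / 9 := by
    rw [Nat.cast_ofNat, div_div, abs_div, abs_of_pos (by norm_num : (0 : ℝ) < 3 * 3)]; norm_num
  refine areaLawOnBall_of_pair (n := n) (by norm_num) (βW / 3) hc hv hP hV ?_ h₁ r hmv ?_
  · rw [habs]; exact hR
  · rw [habs]; exact hrow

/-- **`SU(3)`, `d = 4`, P11, one-parameter row schema**: `0 ≤ β_W ≤ 11/20`, `0 ≤ ε ≤ 1/2`, `T(2ε)(14/15)β_W + T(ε)·0.8945·ε < 1` ⇒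
`AreaLawOnBall 3 4 (β_W/3) (2ε) ε r mv` GIVEN H1, H2. [folklore] -/
theorem su3_hsRow4 (r : ℕ) {mv : ℕ} (hmv : 1 ≤ mv) (hP : OneLinkPoincareSUN 3 (3 / 5) (4 / 5))
    (hV : OneLinkVarianceBound 3 (11 / 30) (49 / 20)) {βW ε : ℝ} (hβ0 : 0 ≤ βW) (hβ : βW ≤ 11 / 20) (hε0 : 0 ≤ ε)
    (hε1 : ε ≤ 1 / 2)
    (hcert : (1 + 2 * ε + (2 * ε) ^ 2 / 2 + (2 * ε) ^ 3 / 6 + 5 / 96 * (2 * ε) ^ 4) * (14 / 15 * βW) +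
      (1 + ε + ε ^ 2 / 2 + ε ^ 3 / 6 + 5 / 96 * ε ^ 4) * 0.8945 * ε < 1) :
    AreaLawOnBall 3 4 (βW / 3) (2 * ε) ε r mv := by
  show AreaLawOnBall 3 (3 + 1) (βW / 3) (2 * ε) ε r mv
  have e : 2 * ((3 : ℕ) : ℝ) * (|βW| / 9) * Real.sqrt (4 / 5 * (49 / 20)) = 14 / 15 * βW := by
    have hsq : Real.sqrt (4 / 5 * (49 / 20)) = 7 / 5 := by
      rw [show (4 / 5 * (49 / 20) : ℝ) = (7 / 5) ^ 2 by norm_num, Real.sqrt_sq (by norm_num)]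
    rw [abs_of_nonneg hβ0, hsq]; push_cast; ring
  refine su3_areaLawOnBallHS_of_pair (n := 3) (by norm_num) (by norm_num) (hP.mono (by norm_num) le_rfl) hV
    (by rw [abs_of_nonneg hβ0]; push_cast; linarith) hε0 r hmv (lt_of_le_of_lt ?_ hcert)
  rw [e]
  exact hs_rowsum_majorant hε0 hε1 (by positivity) le_rfl sqrt_four_fifths_le

/-- **`SU(3)`, `d = 4`, P35, one-parameter row schema**: `0 ≤ β_W ≤ 9/10`, `0 ≤ ε ≤ 1/2`, `T(2ε)(2/3)(1.6493)β_W + T(ε)·0.8945·ε < 1` ⇒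
`AreaLawOnBall 3 4 (β_W/3) (2ε) ε r mv` GIVEN H1, H2′. [folklore] -/
theorem su3_hsRow4' (r : ℕ) {mv : ℕ} (hmv : 1 ≤ mv) (hP : OneLinkPoincareSUN 3 (3 / 5) (4 / 5))
    (hV : OneLinkVarianceBound 3 (3 / 5) (17 / 5)) {βW ε : ℝ} (hβ0 : 0 ≤ βW) (hβ : βW ≤ 9 / 10) (hε0 : 0 ≤ ε)
    (hε1 : ε ≤ 1 / 2)
    (hcert : (1 + 2 * ε + (2 * ε) ^ 2 / 2 + (2 * ε) ^ 3 / 6 + 5 / 96 * (2 * ε) ^ 4) * (2 / 3 * 1.6493 * βW) +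
      (1 + ε + ε ^ 2 / 2 + ε ^ 3 / 6 + 5 / 96 * ε ^ 4) * 0.8945 * ε < 1) :
    AreaLawOnBall 3 4 (βW / 3) (2 * ε) ε r mv := by
  show AreaLawOnBall 3 (3 + 1) (βW / 3) (2 * ε) ε r mv
  have e : 2 * ((3 : ℕ) : ℝ) * (|βW| / 9) * Real.sqrt (4 / 5 * (17 / 5)) = 2 / 3 * βW * Real.sqrt (4 / 5 * (17 / 5)) := by
    rw [abs_of_nonneg hβ0]; push_cast; ring
  refine su3_areaLawOnBallHS_of_pair (n := 3) (by norm_num) (by norm_num) hP hV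
    (by rw [abs_of_nonneg hβ0]; push_cast; linarith) hε0 r hmv (lt_of_le_of_lt ?_ hcert)
  rw [e]
  have hsq35 : Real.sqrt (4 / 5 * (17 / 5)) ≤ 1.6493 := by
    rw [show (1.6493 : ℝ) = Real.sqrt (1.6493 ^ 2) by rw [Real.sqrt_sq (by norm_num)]]
    exact Real.sqrt_le_sqrt (by norm_num)
  exact hs_rowsum_majorant hε0 hε1 (by positivity) (by nlinarith [hsq35]) sqrt_four_fifths_le

/-- **`SU(3)`, `d = 3`, P11, row schema** (`β_W ≤ 33/40`): `T(2ε)(28/45)β_W + T(ε)·0.8945·ε < 1` ⇒ `AreaLawOnBall 3 3 (β_W/3) (2ε) ε r mv`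
GIVEN H1, H2. [folklore] -/
theorem su3_hsRow3 (r : ℕ) {mv : ℕ} (hmv : 1 ≤ mv) (hP : OneLinkPoincareSUN 3 (3 / 5) (4 / 5))
    (hV : OneLinkVarianceBound 3 (11 / 30) (49 / 20)) {βW ε : ℝ} (hβ0 : 0 ≤ βW) (hβ : βW ≤ 33 / 40) (hε0 : 0 ≤ ε)
    (hε1 : ε ≤ 1 / 2)
    (hcert : (1 + 2 * ε + (2 * ε) ^ 2 / 2 + (2 * ε) ^ 3 / 6 + 5 / 96 * (2 * ε) ^ 4) * (28 / 45 * βW) +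
      (1 + ε + ε ^ 2 / 2 + ε ^ 3 / 6 + 5 / 96 * ε ^ 4) * 0.8945 * ε < 1) :
    AreaLawOnBall 3 3 (βW / 3) (2 * ε) ε r mv := by
  show AreaLawOnBall 3 (2 + 1) (βW / 3) (2 * ε) ε r mv
  have e : 2 * ((2 : ℕ) : ℝ) * (|βW| / 9) * Real.sqrt (4 / 5 * (49 / 20)) = 28 / 45 * βW := by
    have hsq : Real.sqrt (4 / 5 * (49 / 20)) = 7 / 5 := by
      rw [show (4 / 5 * (49 / 20) : ℝ) = (7 / 5) ^ 2 by norm_num, Real.sqrt_sq (by norm_num)]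
    rw [abs_of_nonneg hβ0, hsq]; push_cast; ring
  refine su3_areaLawOnBallHS_of_pair (n := 2) (by norm_num) (by norm_num) (hP.mono (by norm_num) le_rfl) hV
    (by rw [abs_of_nonneg hβ0]; push_cast; linarith) hε0 r hmv (lt_of_le_of_lt ?_ hcert)
  rw [e]
  exact hs_rowsum_majorant hε0 hε1 (by positivity) le_rfl sqrt_four_fifths_le

/-- **`SU(3)`, `d = 3`, P35, row schema** (`β_W ≤ 27/20`): `T(2ε)(4/9)(1.6493)β_W + T(ε)·0.8945·ε < 1` ⇒ `AreaLawOnBall 3 3 (β_W/3) (2ε) ε r mv`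
GIVEN H1, H2′. [folklore] -/
theorem su3_hsRow3' (r : ℕ) {mv : ℕ} (hmv : 1 ≤ mv) (hP : OneLinkPoincareSUN 3 (3 / 5) (4 / 5))
    (hV : OneLinkVarianceBound 3 (3 / 5) (17 / 5)) {βW ε : ℝ} (hβ0 : 0 ≤ βW) (hβ : βW ≤ 27 / 20) (hε0 : 0 ≤ ε)
    (hε1 : ε ≤ 1 / 2)
    (hcert : (1 + 2 * ε + (2 * ε) ^ 2 / 2 + (2 * ε) ^ 3 / 6 + 5 / 96 * (2 * ε) ^ 4) * (4 / 9 * 1.6493 * βW) +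
      (1 + ε + ε ^ 2 / 2 + ε ^ 3 / 6 + 5 / 96 * ε ^ 4) * 0.8945 * ε < 1) :
    AreaLawOnBall 3 3 (βW / 3) (2 * ε) ε r mv := by
  show AreaLawOnBall 3 (2 + 1) (βW / 3) (2 * ε) ε r mv
  have e : 2 * ((2 : ℕ) : ℝ) * (|βW| / 9) * Real.sqrt (4 / 5 * (17 / 5)) = 4 / 9 * βW * Real.sqrt (4 / 5 * (17 / 5)) := by
    rw [abs_of_nonneg hβ0]; push_cast; ring
  refine su3_areaLawOnBallHS_of_pair (n := 2) (by norm_num) (by norm_num) hP hV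
    (by rw [abs_of_nonneg hβ0]; push_cast; linarith) hε0 r hmv (lt_of_le_of_lt ?_ hcert)
  rw [e]
  have hsq35 : Real.sqrt (4 / 5 * (17 / 5)) ≤ 1.6493 := by
    rw [show (1.6493 : ℝ) = Real.sqrt (1.6493 ^ 2) by rw [Real.sqrt_sq (by norm_num)]]
    exact Real.sqrt_le_sqrt (by norm_num)
  exact hs_rowsum_majorant hε0 hε1 (by positivity) (by nlinarith [hsq35]) sqrt_four_fifths_le

/-- `SU(3)`, `d = 4`, P11: row `(1/4, 0.381)`. [folklore] -/
theorem su3_hsRow4_1_4 (r : ℕ) {mv : ℕ} (hmv : 1 ≤ mv) (hP : OneLinkPoincareSUN 3 (3 / 5) (4 / 5))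
    (hV : OneLinkVarianceBound 3 (11 / 30) (49 / 20)) :
    AreaLawOnBall 3 4 ((1 / 4 : ℝ) / 3) (2 * (381 / 1000)) (381 / 1000) r mv :=
  su3_hsRow4 r hmv hP hV (by norm_num) (by norm_num) (by norm_num) (by norm_num) (by norm_num)

/-- `SU(3)`, `d = 4`, P11: row `(1/3, 0.325)` (vertex door: `0.261`). [folklore] -/
theorem su3_hsRow4_1_3 (r : ℕ) {mv : ℕ} (hmv : 1 ≤ mv) (hP : OneLinkPoincareSUN 3 (3 / 5) (4 / 5))
    (hV : OneLinkVarianceBound 3 (11 / 30) (49 / 20)) :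
    AreaLawOnBall 3 4 ((1 / 3 : ℝ) / 3) (2 * (13 / 40)) (13 / 40) r mv :=
  su3_hsRow4 r hmv hP hV (by norm_num) (by norm_num) (by norm_num) (by norm_num) (by norm_num)

/-- `SU(3)`, `d = 4`, P11: row `(9/20, 0.257)` — half the radius cap `9/10` of the engine-2 pairs (design D7 (i)). [folklore] -/
theorem su3_hsRow4_9_20 (r : ℕ) {mv : ℕ} (hmv : 1 ≤ mv) (hP : OneLinkPoincareSUN 3 (3 / 5) (4 / 5))
    (hV : OneLinkVarianceBound 3 (11 / 30) (49 / 20)) :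
    AreaLawOnBall 3 4 ((9 / 20 : ℝ) / 3) (2 * (257 / 1000)) (257 / 1000) r mv :=
  su3_hsRow4 r hmv hP hV (by norm_num) (by norm_num) (by norm_num) (by norm_num) (by norm_num)

/-- `SU(3)`, `d = 4`, P11: row `(1/2, 0.230)` (vertex door: `0.160`). [folklore] -/
theorem su3_hsRow4_1_2 (r : ℕ) {mv : ℕ} (hmv : 1 ≤ mv) (hP : OneLinkPoincareSUN 3 (3 / 5) (4 / 5))
    (hV : OneLinkVarianceBound 3 (11 / 30) (49 / 20)) :
    AreaLawOnBall 3 4 ((1 / 2 : ℝ) / 3) (2 * (23 / 100)) (23 / 100) r mv :=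
  su3_hsRow4 r hmv hP hV (by norm_num) (by norm_num) (by norm_num) (by norm_num) (by norm_num)

/-- `SU(3)`, `d = 4`, P11: row `(11/20, 0.205)` — the radius cap of P11 (vertex door: `0.138`). [folklore] -/
theorem su3_hsRow4_11_20 (r : ℕ) {mv : ℕ} (hmv : 1 ≤ mv) (hP : OneLinkPoincareSUN 3 (3 / 5) (4 / 5))
    (hV : OneLinkVarianceBound 3 (11 / 30) (49 / 20)) :
    AreaLawOnBall 3 4 ((11 / 20 : ℝ) / 3) (2 * (41 / 200)) (41 / 200) r mv :=
  su3_hsRow4 r hmv hP hV (by norm_num) (by norm_num) (by norm_num) (by norm_num) (by norm_num)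

/-- `SU(3)`, `d = 4`, P35: row `(3/5, 0.134)`. [folklore] -/
theorem su3_hsRow4_3_5 (r : ℕ) {mv : ℕ} (hmv : 1 ≤ mv) (hP : OneLinkPoincareSUN 3 (3 / 5) (4 / 5))
    (hV : OneLinkVarianceBound 3 (3 / 5) (17 / 5)) :
    AreaLawOnBall 3 4 ((3 / 5 : ℝ) / 3) (2 * (67 / 500)) (67 / 500) r mv :=
  su3_hsRow4' r hmv hP hV (by norm_num) (by norm_num) (by norm_num) (by norm_num) (by norm_num)

/-- `SU(3)`, `d = 4`, P35: row `(2/3, 0.102)`. [folklore] -/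
theorem su3_hsRow4_2_3 (r : ℕ) {mv : ℕ} (hmv : 1 ≤ mv) (hP : OneLinkPoincareSUN 3 (3 / 5) (4 / 5))
    (hV : OneLinkVarianceBound 3 (3 / 5) (17 / 5)) :
    AreaLawOnBall 3 4 ((2 / 3 : ℝ) / 3) (2 * (51 / 500)) (51 / 500) r mv :=
  su3_hsRow4' r hmv hP hV (by norm_num) (by norm_num) (by norm_num) (by norm_num) (by norm_num)

/-- `SU(3)`, `d = 4`, P35: row `(3/4, 0.064)` (twice CNS25's printed `SU(3)` Wilson threshold `3/8`; vertex door: `0.036`). [folklore] -/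
theorem su3_hsRow4_3_4 (r : ℕ) {mv : ℕ} (hmv : 1 ≤ mv) (hP : OneLinkPoincareSUN 3 (3 / 5) (4 / 5))
    (hV : OneLinkVarianceBound 3 (3 / 5) (17 / 5)) :
    AreaLawOnBall 3 4 ((3 / 4 : ℝ) / 3) (2 * (8 / 125)) (8 / 125) r mv :=
  su3_hsRow4' r hmv hP hV (by norm_num) (by norm_num) (by norm_num) (by norm_num) (by norm_num)

/-- `SU(3)`, `d = 4`, P35: row `(4/5, 0.043)`. [folklore] -/
theorem su3_hsRow4_4_5 (r : ℕ) {mv : ℕ} (hmv : 1 ≤ mv) (hP : OneLinkPoincareSUN 3 (3 / 5) (4 / 5))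
    (hV : OneLinkVarianceBound 3 (3 / 5) (17 / 5)) :
    AreaLawOnBall 3 4 ((4 / 5 : ℝ) / 3) (2 * (43 / 1000)) (43 / 1000) r mv :=
  su3_hsRow4' r hmv hP hV (by norm_num) (by norm_num) (by norm_num) (by norm_num) (by norm_num)

/-- `SU(3)`, `d = 3`, P11: row `(1/2, 0.325)`. [folklore] -/
theorem su3_hsRow3_1_2 (r : ℕ) {mv : ℕ} (hmv : 1 ≤ mv) (hP : OneLinkPoincareSUN 3 (3 / 5) (4 / 5))
    (hV : OneLinkVarianceBound 3 (11 / 30) (49 / 20)) :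
    AreaLawOnBall 3 3 ((1 / 2 : ℝ) / 3) (2 * (13 / 40)) (13 / 40) r mv :=
  su3_hsRow3 r hmv hP hV (by norm_num) (by norm_num) (by norm_num) (by norm_num) (by norm_num)

/-- `SU(3)`, `d = 3`, P11: row `(3/4, 0.230)`. [folklore] -/
theorem su3_hsRow3_3_4 (r : ℕ) {mv : ℕ} (hmv : 1 ≤ mv) (hP : OneLinkPoincareSUN 3 (3 / 5) (4 / 5))
    (hV : OneLinkVarianceBound 3 (11 / 30) (49 / 20)) :
    AreaLawOnBall 3 3 ((3 / 4 : ℝ) / 3) (2 * (23 / 100)) (23 / 100) r mv :=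
  su3_hsRow3 r hmv hP hV (by norm_num) (by norm_num) (by norm_num) (by norm_num) (by norm_num)

/-- `SU(3)`, `d = 3`, P35: row `(9/10, 0.134)`. [folklore] -/
theorem su3_hsRow3_9_10 (r : ℕ) {mv : ℕ} (hmv : 1 ≤ mv) (hP : OneLinkPoincareSUN 3 (3 / 5) (4 / 5))
    (hV : OneLinkVarianceBound 3 (3 / 5) (17 / 5)) :
    AreaLawOnBall 3 3 ((9 / 10 : ℝ) / 3) (2 * (67 / 500)) (67 / 500) r mv :=
  su3_hsRow3' r hmv hP hV (by norm_num) (by norm_num) (by norm_num) (by norm_num) (by norm_num)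

/-- `SU(3)`, `d = 3`, P35: row `(1, 0.102)`. [folklore] -/
theorem su3_hsRow3_1 (r : ℕ) {mv : ℕ} (hmv : 1 ≤ mv) (hP : OneLinkPoincareSUN 3 (3 / 5) (4 / 5))
    (hV : OneLinkVarianceBound 3 (3 / 5) (17 / 5)) :
    AreaLawOnBall 3 3 ((1 : ℝ) / 3) (2 * (51 / 500)) (51 / 500) r mv :=
  su3_hsRow3' r hmv hP hV (by norm_num) (by norm_num) (by norm_num) (by norm_num) (by norm_num)

/-- `SU(3)`, `d = 3`, P35: row `(6/5, 0.043)`. [folklore] -/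
theorem su3_hsRow3_6_5 (r : ℕ) {mv : ℕ} (hmv : 1 ≤ mv) (hP : OneLinkPoincareSUN 3 (3 / 5) (4 / 5))
    (hV : OneLinkVarianceBound 3 (3 / 5) (17 / 5)) :
    AreaLawOnBall 3 3 ((6 / 5 : ℝ) / 3) (2 * (43 / 1000)) (43 / 1000) r mv :=
  su3_hsRow3' r hmv hP hV (by norm_num) (by norm_num) (by norm_num) (by norm_num) (by norm_num)

/-! ### 4. Numbers -/

/-- Numbers at one glance: `(4/3)² = (2/3)(8/3)`, `1.1548² ≥ (2/3)·2`, `0.8165² ≥ 2/3`, `0.8945² ≥ 4/5`, `(7/5)² = (4/5)(49/20)`,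
`1.6493² ≥ (4/5)(17/5)`; the `ε = 0` door values at the radius caps: `SU(2)` pair B `(3/2)(1.1548)(1/5) < 1`, `SU(3)` P11 `(14/15)(11/20) < 1`,
P35 `(2/3)(1.6493)(9/10) < 1` — all displayed ranges are radius-capped. [folklore] -/
theorem hsRows_numbers :
    (4 / 3 : ℝ) ^ 2 = 2 / 3 * (8 / 3) ∧ (1.1548 : ℝ) ^ 2 ≥ 2 / 3 * 2 ∧ (0.8165 : ℝ) ^ 2 ≥ 2 / 3 ∧ (0.8945 : ℝ) ^ 2 ≥ 4 / 5 ∧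
      (7 / 5 : ℝ) ^ 2 = 4 / 5 * (49 / 20) ∧ (1.6493 : ℝ) ^ 2 ≥ 4 / 5 * (17 / 5) ∧ (3 / 2 : ℝ) * 1.1548 * (1 / 5) < 1 ∧
      (14 / 15 : ℝ) * (11 / 20) < 1 ∧ (2 / 3 : ℝ) * 1.6493 * (9 / 10) < 1 := by
  norm_num

end Summit.Ventures.YMGap.RobustBallPair

end
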